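import Literature.Analysis.InverseSpectral.KreinStringWeylNeg
import HarnessLib

/-!
# Kreĭn strings: the Lagrange identity for two solutions and Green's formula

For two continuous solutions `y₁`, `y₂` of the string equation with (possibly different) spectral
parameters `z₁`, `z₂` and initial data `(a₁, b₁)`, `(a₂, b₂)` (`KreinString.IsSolution`), with right
derivatives `yᵢ⁺'(x) = bᵢ - zᵢ ∫_{[0,x]} yᵢ dm`, the **Lagrange identity**

  `y₁(x) y₂⁺'(x) - y₁⁺'(x) y₂(x) = (a₁ b₂ - b₁ a₂) + (z₁ - z₂) ∫_{[0,x]} y₁ y₂ dm`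

holds on `[0, L)` (`IsSolution.lagrange`; two integrations by parts, Kac–Kreĭn 1974 §1).
Consequences:

* conjugation symmetry `conj φ(x, z) = φ(x, conj z)`, `conj ψ(x, z) = ψ(x, conj z)`;
* **Green's formula** `φ(x,z)·φ⁺'(x,z̄) - φ⁺'(x,z)·φ(x,z̄) = (z - z̄) ∫_{[0,x]} |φ|² dm` and the
  absence of zeros of `φ(·, z)` on `[0, L)` for `Im z ≠ 0` (`phi_ne_zero_of_im_ne_zero`), hence for
  all `z ∈ ℂ ∖ [0, ∞)` (`phi_ne_zero_of_mem_offNonnegAxis`) and `ψ/φ = ∫₀ˣ φ⁻²` there;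
* the finite-depth Weyl quotient `q_x(z) = ψ(x,z)/φ(x,z)` satisfies
  `Im q_x(z) = Im z ∫_{[0,x]} |ψ - q_x(z) φ|² dm` (`im_psi_div_phi`), in particular
  `Im q_x(z) · Im z ≥ 0` (the Herglotz property at finite depth).

## References

KacKrein1974 (§§1–2), DymMcKean1976 (Ch. 5).
-/

open MeasureTheory Filter Set Topology
open scoped ENNReal Nat ComplexConjugate

noncomputable section

namespace Literature.Analysis.InverseSpectral

/-- The Lebesgue integral of a constant over `[0, t]`: `∫_{[0,t]} c dt = t c` (complex constant).
[folklore] -/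
lemma integral_Icc_const_eq {t : ℝ} (ht : 0 ≤ t) (c : ℂ) : ∫ _ in Icc 0 t, c = (t : ℂ) * c := by
  rw [setIntegral_const, Real.volume_real_Icc_of_le ht, sub_zero, Complex.real_smul]

namespace KreinString

variable (S : KreinString)

variable {S} in
/-- A solution in integral form is `a + b x - z ∫₀ˣ Y` with `Y(t) = ∫_{[0,t]} y dm`, i.e.
`y = a + ∫₀ˣ y⁺'` with the right derivative `y⁺' = b - z Y`. [folklore] -/
theorem IsSolution.eq_sub_integral {z a b : ℂ} {y : ℝ → ℂ} (h : S.IsSolution z a b y) {x : ℝ}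
    (hx : x ∈ S.dom) :
    y x = a + b * x - z * ∫ t in Icc 0 x, (∫ u in Icc 0 t, y u ∂S.massMeasure) := by
  rw [h.2 x hx, integral_sub_mul_eq_integral_integral hx.1 (S.massMeasure_Icc_lt_top hx).ne
    (S.integrableOn_Icc_of_continuousOn hx (h.1.mono (S.Icc_subset_dom hx)))]

variable {S} in
/-- **Energy form of the Lagrange identity.** If `y₁`, `y₂` solve the string equation with
parameters `z₁`, `z₂` and initial data `(a₁,b₁)`, `(a₂,b₂)`, then with the right derivatives
`yᵢ⁺'(t) = bᵢ - zᵢ ∫_{[0,t]} yᵢ dm`,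
`y₁(x) y₂⁺'(x) = a₁ b₂ + ∫₀ˣ y₁⁺' y₂⁺' dt - z₂ ∫_{[0,x]} y₁ y₂ dm` on `[0, L)` (one integration by
parts: `y₁ y₂⁺' = ∫ y₂⁺' dy₁ + ∫ y₁ d(y₂⁺')`). [cite: KacKrein1974, §1] -/
theorem IsSolution.mul_deriv_eq {z₁ z₂ a₁ b₁ a₂ b₂ : ℂ} {y₁ y₂ : ℝ → ℂ}
    (h₁ : S.IsSolution z₁ a₁ b₁ y₁) (h₂ : S.IsSolution z₂ a₂ b₂ y₂) {x : ℝ} (hx : x ∈ S.dom) :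
    y₁ x * (b₂ - z₂ * ∫ u in Icc 0 x, y₂ u ∂S.massMeasure) =
      a₁ * b₂ + (∫ t in Icc 0 x, (b₁ - z₁ * ∫ u in Icc 0 t, y₁ u ∂S.massMeasure) *
        (b₂ - z₂ * ∫ u in Icc 0 t, y₂ u ∂S.massMeasure)) -
        z₂ * ∫ u in Icc 0 x, y₁ u * y₂ u ∂S.massMeasure := by
  obtain ⟨Y₁, hY₁⟩ : ∃ Y : ℝ → ℂ, Y = fun t => ∫ u in Icc 0 t, y₁ u ∂S.massMeasure := ⟨_, rfl⟩
  obtain ⟨Y₂, hY₂⟩ : ∃ Y : ℝ → ℂ, Y = fun t => ∫ u in Icc 0 t, y₂ u ∂S.massMeasure := ⟨_, rfl⟩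
  have hY₁t : ∀ t, ∫ u in Icc 0 t, y₁ u ∂S.massMeasure = Y₁ t := fun t => by rw [hY₁]
  have hY₂t : ∀ t, ∫ u in Icc 0 t, y₂ u ∂S.massMeasure = Y₂ t := fun t => by rw [hY₂]
  simp only [hY₁t, hY₂t]
  -- integrability on `[0, x]`
  have hμx : S.massMeasure (Icc 0 x) ≠ ⊤ := (S.massMeasure_Icc_lt_top hx).ne
  haveI : IsFiniteMeasure (S.massMeasure.restrict (Icc 0 x)) := isFiniteMeasure_restrict.2 hμx
  haveI : IsFiniteMeasure ((volume : Measure ℝ).restrict (Icc 0 x)) :=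
    isFiniteMeasure_restrict.2 measure_Icc_lt_top.ne
  have hy₁c : ContinuousOn y₁ (Icc 0 x) := h₁.1.mono (S.Icc_subset_dom hx)
  have hy₂c : ContinuousOn y₂ (Icc 0 x) := h₂.1.mono (S.Icc_subset_dom hx)
  have hy₁i : IntegrableOn y₁ (Icc 0 x) S.massMeasure := S.integrableOn_Icc_of_continuousOn hx hy₁c
  have hy₂i : IntegrableOn y₂ (Icc 0 x) S.massMeasure := S.integrableOn_Icc_of_continuousOn hx hy₂c
  have hy₁₂i : IntegrableOn (fun u => y₁ u * y₂ u) (Icc 0 x) S.massMeasure :=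
    S.integrableOn_Icc_of_continuousOn hx (hy₁c.mul hy₂c)
  have hY₁i : IntegrableOn Y₁ (Icc 0 x) := by rw [hY₁]; exact integrableOn_integral_Icc hμx hy₁i
  have hY₂i : IntegrableOn Y₂ (Icc 0 x) := by rw [hY₂]; exact integrableOn_integral_Icc hμx hy₂i
  have hY₁b : ∀ t ∈ Icc 0 x, ‖Y₁ t‖ ≤ ∫ u in Icc 0 x, ‖y₁ u‖ ∂S.massMeasure := fun t ht => by
    rw [← hY₁t]; exact norm_setIntegral_Icc_le hy₁i ht
  have hY₁₂i : IntegrableOn (fun t => Y₁ t * Y₂ t) (Icc 0 x) :=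
    Integrable.bdd_mul hY₂i hY₁i.aestronglyMeasurable
      (ae_restrict_of_forall_mem measurableSet_Icc hY₁b)
  have hdi : IntegrableOn (fun t => (b₁ - z₁ * Y₁ t) * Y₂ t) (Icc 0 x) :=
    ((hY₂i.const_mul b₁).sub (hY₁₂i.const_mul z₁)).congr (ae_of_all _ fun t => by
      simp only [Pi.sub_apply]; ring)
  -- FTC form of `y₁`
  have hy₁_eq : ∀ t ∈ Icc 0 x, y₁ t = a₁ + b₁ * t - z₁ * ∫ s in Icc 0 t, Y₁ s := fun t ht => by
    have h := h₁.eq_sub_integral (S.Icc_subset_dom hx ht)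
    simp only [hY₁t] at h
    exact h
  have ha1 : ∀ t ∈ Icc 0 x, ∫ s in Icc 0 t, (b₁ - z₁ * Y₁ s) = y₁ t - a₁ := fun t ht => by
    haveI : IsFiniteMeasure ((volume : Measure ℝ).restrict (Icc 0 t)) :=
      isFiniteMeasure_restrict.2 measure_Icc_lt_top.ne
    rw [integral_sub (integrable_const _) ((hY₁i.mono_set (Icc_subset_Icc_right ht.2)).const_mul _),
      integral_const_mul, integral_Icc_const_eq ht.1, hy₁_eq t ht]
    ring
  -- by parts: `a = y₁⁺'`, `b = y₂`
  have hq1 : ∫ u in Icc 0 x, y₂ u * (∫ s in Icc 0 u, (b₁ - z₁ * Y₁ s)) ∂S.massMeasure =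
      (∫ u in Icc 0 x, y₁ u * y₂ u ∂S.massMeasure) - a₁ * Y₂ x := by
    rw [← hY₂t, ← integral_const_mul, ← integral_sub hy₁₂i (hy₂i.const_mul _)]
    refine setIntegral_congr_fun measurableSet_Icc (fun u hu => ?_)
    rw [ha1 u hu]; ring
  have E1 : y₁ x * Y₂ x = (∫ u in Icc 0 x, y₁ u * y₂ u ∂S.massMeasure) +
      ∫ t in Icc 0 x, (b₁ - z₁ * Y₁ t) * Y₂ t := by
    have h := integral_mul_integral_eq_parts hμx (a := fun t => b₁ - z₁ * Y₁ t)
      (by exact (integrable_const _).sub (hY₁i.const_mul z₁)) hy₂i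
    simp only [hY₂t] at h
    rw [ha1 x ⟨hx.1, le_rfl⟩, hq1] at h
    linear_combination h
  have E7 : ∫ t in Icc 0 x, (b₁ - z₁ * Y₁ t) * (b₂ - z₂ * Y₂ t) =
      b₂ * (y₁ x - a₁) - z₂ * ∫ t in Icc 0 x, (b₁ - z₁ * Y₁ t) * Y₂ t := by
    rw [← ha1 x ⟨hx.1, le_rfl⟩, ← integral_const_mul, ← integral_const_mul,
      ← integral_sub (f := fun t => b₂ * (b₁ - z₁ * Y₁ t))
        (g := fun t => z₂ * ((b₁ - z₁ * Y₁ t) * Y₂ t))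
        (by exact ((integrable_const b₁).sub (hY₁i.const_mul z₁)).const_mul b₂)
        (hdi.const_mul z₂)]
    exact integral_congr_ae (ae_of_all _ fun t => by ring)
  linear_combination (-z₂) * E1 - E7

variable {S} in
/-- **Lagrange identity for two solutions.** If `y₁`, `y₂` solve the string equation with parameters
`z₁`, `z₂` and initial data `(a₁,b₁)`, `(a₂,b₂)`, then with `yᵢ⁺'(x) = bᵢ - zᵢ ∫_{[0,x]} yᵢ dm`,
`y₁(x) y₂⁺'(x) - y₁⁺'(x) y₂(x) = (a₁b₂ - b₁a₂) + (z₁ - z₂) ∫_{[0,x]} y₁ y₂ dm` on `[0, L)`.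
[cite: KacKrein1974, §1] -/
theorem IsSolution.lagrange {z₁ z₂ a₁ b₁ a₂ b₂ : ℂ} {y₁ y₂ : ℝ → ℂ}
    (h₁ : S.IsSolution z₁ a₁ b₁ y₁) (h₂ : S.IsSolution z₂ a₂ b₂ y₂) {x : ℝ} (hx : x ∈ S.dom) :
    y₁ x * (b₂ - z₂ * ∫ u in Icc 0 x, y₂ u ∂S.massMeasure) -
      (b₁ - z₁ * ∫ u in Icc 0 x, y₁ u ∂S.massMeasure) * y₂ x =
      (a₁ * b₂ - b₁ * a₂) + (z₁ - z₂) * ∫ u in Icc 0 x, y₁ u * y₂ u ∂S.massMeasure := by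
  have E1 := h₁.mul_deriv_eq h₂ hx
  have E2 := h₂.mul_deriv_eq h₁ hx
  have hP : ∫ u in Icc 0 x, y₂ u * y₁ u ∂S.massMeasure =
      ∫ u in Icc 0 x, y₁ u * y₂ u ∂S.massMeasure :=
    integral_congr_ae (ae_of_all _ fun u => by ring)
  have hT : ∫ t in Icc 0 x, (b₂ - z₂ * ∫ u in Icc 0 t, y₂ u ∂S.massMeasure) *
      (b₁ - z₁ * ∫ u in Icc 0 t, y₁ u ∂S.massMeasure) =
      ∫ t in Icc 0 x, (b₁ - z₁ * ∫ u in Icc 0 t, y₁ u ∂S.massMeasure) *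
      (b₂ - z₂ * ∫ u in Icc 0 t, y₂ u ∂S.massMeasure) :=
    integral_congr_ae (ae_of_all _ fun t => by ring)
  rw [hP, hT] at E2
  linear_combination E1 - E2

/-! ### Conjugation symmetry -/

/-- `conj φ(x, z) = φ(x, conj z)` (the Picard series has real coefficients). [folklore] -/
lemma conj_phi (z : ℂ) (x : ℝ) : conj (S.phi z x) = S.phi (conj z) x := by
  rw [phi_eq]
  simp only
  rw [Complex.conj_tsum]
  refine tsum_congr (fun n => ?_)
  simp [map_mul, map_pow, map_neg, Complex.conj_ofReal]

/-- `conj ψ(x, z) = ψ(x, conj z)`. [folklore] -/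
lemma conj_psi (z : ℂ) (x : ℝ) : conj (S.psi z x) = S.psi (conj z) x := by
  rw [psi_eq]
  simp only
  rw [Complex.conj_tsum]
  refine tsum_congr (fun n => ?_)
  simp [map_mul, map_pow, map_neg, Complex.conj_ofReal]

variable {S} in
/-- The conjugate of a solution solves the conjugate equation. [folklore] -/
theorem IsSolution.conj {z a b : ℂ} {y : ℝ → ℂ} (h : S.IsSolution z a b y) :
    S.IsSolution (conj z) (conj a) (conj b) (fun x => conj (y x)) := by
  refine ⟨Complex.continuous_conj.comp_continuousOn h.1, fun x hx => ?_⟩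
  have := congrArg conj (h.2 x hx)
  simp only [map_add, map_sub, map_mul, Complex.conj_ofReal] at this
  show conj (y x) = conj a + conj b * x -
    conj z * ∫ s in Icc 0 x, ((x - s : ℝ) : ℂ) * conj (y s) ∂S.massMeasure
  have hint : ∫ s in Icc 0 x, conj (((x - s : ℝ) : ℂ) * y s) ∂S.massMeasure =
      ∫ s in Icc 0 x, ((x - s : ℝ) : ℂ) * conj (y s) ∂S.massMeasure :=
    setIntegral_congr_fun measurableSet_Icc (fun s _ => by simp [map_mul, Complex.conj_ofReal])
  rw [this, ← integral_conj, hint]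

variable {S} in
/-- Linear combinations of solutions (same parameter `z`) are solutions. [folklore] -/
theorem IsSolution.lincomb {z a₁ b₁ a₂ b₂ : ℂ} {y₁ y₂ : ℝ → ℂ} (h₁ : S.IsSolution z a₁ b₁ y₁)
    (h₂ : S.IsSolution z a₂ b₂ y₂) (c₁ c₂ : ℂ) :
    S.IsSolution z (c₁ * a₁ + c₂ * a₂) (c₁ * b₁ + c₂ * b₂) (fun u => c₁ * y₁ u + c₂ * y₂ u) := by
  refine ⟨(continuousOn_const.mul h₁.1).add (continuousOn_const.mul h₂.1), fun x hx => ?_⟩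
  have hint : ∀ {y : ℝ → ℂ}, ContinuousOn y S.dom →
      IntegrableOn (fun s => ((x - s : ℝ) : ℂ) * y s) (Icc 0 x) S.massMeasure := fun hy =>
    S.integrableOn_Icc_of_continuousOn hx ((Complex.continuous_ofReal.comp_continuousOn
      (continuousOn_const.sub continuousOn_id)).mul (hy.mono (S.Icc_subset_dom hx)))
  have heq : ∫ s in Icc 0 x, ((x - s : ℝ) : ℂ) * (c₁ * y₁ s + c₂ * y₂ s) ∂S.massMeasure =
      c₁ * (∫ s in Icc 0 x, ((x - s : ℝ) : ℂ) * y₁ s ∂S.massMeasure) +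
        c₂ * ∫ s in Icc 0 x, ((x - s : ℝ) : ℂ) * y₂ s ∂S.massMeasure := by
    rw [← integral_const_mul, ← integral_const_mul, ← integral_add ((hint h₁.1).const_mul _)
      ((hint h₂.1).const_mul _)]
    exact integral_congr_ae (ae_of_all _ fun s => by ring)
  show c₁ * y₁ x + c₂ * y₂ x = _
  rw [heq, h₁.2 x hx, h₂.2 x hx]
  ring

/-! ### Green's formula and the zeros of `φ(·, z)` -/

/-- `∫_{[0,x]} φ(u,z) φ(u, conj z) dm = ∫_{[0,x]} |φ(u,z)|² dm` (as a real number cast to `ℂ`), and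
similarly for any function against its conjugate. [folklore] -/
lemma integral_mul_conj_eq {x : ℝ} (y : ℝ → ℂ) :
    ∫ u in Icc 0 x, y u * conj (y u) ∂S.massMeasure =
      ((∫ u in Icc 0 x, ‖y u‖ ^ 2 ∂S.massMeasure : ℝ) : ℂ) := by
  rw [← integral_complex_ofReal]
  refine setIntegral_congr_fun measurableSet_Icc (fun u _ => ?_)
  rw [Complex.mul_conj, Complex.normSq_eq_norm_sq]

/-- **`φ(·, z)` has no zeros on `[0, L)` when `Im z ≠ 0`** (Green's formula: a zero at `x` would
force `∫_{[0,x]} |φ|² dm = 0`, hence `φ ≡ 1` on `[0,x]`). [cite: KacKrein1974, §2] -/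
theorem phi_ne_zero_of_im_ne_zero {z : ℂ} (hz : z.im ≠ 0) {x : ℝ} (hx : x ∈ S.dom) :
    S.phi z x ≠ 0 := by
  intro h0
  have hL := (S.isSolution_phi z).lagrange (S.isSolution_phi (conj z)) hx
  have hconj : S.phi (conj z) x = 0 := by rw [← conj_phi, h0, map_zero]
  rw [h0, hconj] at hL
  have hφφ : ∫ u in Icc 0 x, S.phi z u * S.phi (conj z) u ∂S.massMeasure =
      ((∫ u in Icc 0 x, ‖S.phi z u‖ ^ 2 ∂S.massMeasure : ℝ) : ℂ) := by
    rw [← S.integral_mul_conj_eq]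
    refine setIntegral_congr_fun measurableSet_Icc (fun u _ => ?_)
    rw [conj_phi]
  rw [hφφ] at hL
  simp only [zero_mul, mul_zero, sub_self, zero_add] at hL
  -- hL : 0 = (z - conj z) * ↑(∫ ‖φ‖²)
  have hzz : z - conj z ≠ 0 := by
    rw [Complex.sub_conj]
    exact mul_ne_zero (by exact_mod_cast (mul_ne_zero two_ne_zero hz)) Complex.I_ne_zero
  have hint : ∫ u in Icc 0 x, ‖S.phi z u‖ ^ 2 ∂S.massMeasure = 0 := by
    have := (mul_eq_zero.1 hL.symm).resolve_left hzz
    exact_mod_cast this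
  -- nonnegative continuous integrand with zero integral: `φ = 0` `dm`-a.e. on `[0, x]`
  have hφc : ContinuousOn (S.phi z) (Icc 0 x) := (S.isSolution_phi z).1.mono (S.Icc_subset_dom hx)
  have hi : IntegrableOn (fun u => ‖S.phi z u‖ ^ 2) (Icc 0 x) S.massMeasure :=
    S.integrableOn_Icc_of_continuousOn hx (hφc.norm.pow 2)
  have hae : ∀ᵐ u ∂S.massMeasure.restrict (Icc 0 x), S.phi z u = 0 := by
    have h := (integral_eq_zero_iff_of_nonneg_ae (ae_of_all _ fun u => by positivity) hi).1 hint
    filter_upwards [h] with u hu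
    simpa using hu
  have hΦ : ∀ t ∈ Icc 0 x, ∫ u in Icc 0 t, S.phi z u ∂S.massMeasure = 0 := by
    intro t ht
    have h : ∀ᵐ u ∂S.massMeasure.restrict (Icc 0 t), S.phi z u = 0 :=
      ae_restrict_of_ae_restrict_of_subset (Icc_subset_Icc_right ht.2) hae
    rw [integral_congr_ae h]
    simp
  have h1 : S.phi z x = 1 := by
    rw [S.phi_eq_one_sub_integral z hx, setIntegral_congr_fun measurableSet_Icc hΦ]
    simp
  exact one_ne_zero (h1 ▸ h0)

/-- `φ(x, z) ≠ 0` for every `x ∈ [0, L)` and every `z ∈ ℂ ∖ [0, ∞)`. [cite: KacKrein1974, §2] -/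
theorem phi_ne_zero_of_mem_offNonnegAxis {z : ℂ} (hz : z ∈ offNonnegAxis) {x : ℝ}
    (hx : x ∈ S.dom) : S.phi z x ≠ 0 := by
  rcases hz with hz | hz
  · exact S.phi_ne_zero_of_im_ne_zero hz hx
  · by_cases him : z.im = 0
    · have hzs : z = -(((-z.re : ℝ)) : ℂ) := Complex.ext (by simp) (by simp [him])
      rw [hzs]
      exact S.phi_neg_ne_zero (by linarith) hx
    · exact S.phi_ne_zero_of_im_ne_zero him hx

/-- **`ψ/φ = ∫ φ⁻²` off the positive axis**: for `z ∈ ℂ ∖ [0, ∞)` and `x ∈ [0, L)`,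
`ψ(x,z)/φ(x,z) = ∫₀ˣ φ(t,z)⁻² dt`. [cite: Tomisaki1988, §4 (4.1)] -/
theorem psi_div_phi_eq_integral_of_mem_offNonnegAxis {z : ℂ} (hz : z ∈ offNonnegAxis) {x : ℝ}
    (hx : x ∈ S.dom) : S.psi z x / S.phi z x = ∫ t in (0 : ℝ)..x, ((S.phi z t) ^ 2)⁻¹ :=
  S.psi_div_phi_eq_integral z hx (fun _ ht => S.phi_ne_zero_of_mem_offNonnegAxis hz
    (S.Icc_subset_dom hx ht))

/-! ### The Herglotz property at finite depth -/

/-- **Green's formula for the Weyl quotient at finite depth**: for `Im z ≠ 0` and `x ∈ [0, L)`,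
`Im (ψ(x,z)/φ(x,z)) = Im z · ∫_{[0,x]} |ψ(u,z) - (ψ(x,z)/φ(x,z)) φ(u,z)|² dm(u)`
(Lagrange identity for `χ = ψ - q_x φ` and its conjugate, `χ(x) = 0`). [cite: KacKrein1974, §2] -/
theorem im_psi_div_phi {z : ℂ} (hz : z.im ≠ 0) {x : ℝ} (hx : x ∈ S.dom) :
    (S.psi z x / S.phi z x).im = z.im *
      ∫ u in Icc 0 x, ‖S.psi z u - S.psi z x / S.phi z x * S.phi z u‖ ^ 2 ∂S.massMeasure := by
  set m := S.psi z x / S.phi z x with hm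
  have hφ0 := S.phi_ne_zero_of_im_ne_zero hz hx
  -- `χ = ψ - m φ` and its conjugate are solutions
  have hχ : S.IsSolution z (-m) 1 (fun u => S.psi z u - m * S.phi z u) := by
    have h := (S.isSolution_psi z).lincomb (S.isSolution_phi z) 1 (-m)
    have hfun : (fun u => 1 * S.psi z u + -m * S.phi z u) = fun u => S.psi z u - m * S.phi z u :=
      funext fun u => by ring
    have hd1 : (1 : ℂ) * 0 + -m * 1 = -m := by ring
    have hd2 : (1 : ℂ) * 1 + -m * 0 = 1 := by ring
    rw [hfun, hd1, hd2] at h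
    exact h
  have hL := hχ.lagrange hχ.conj hx
  have hR := S.integral_mul_conj_eq (x := x) (fun u => S.psi z u - m * S.phi z u)
  have hχx : S.psi z x - m * S.phi z x = 0 := by rw [hm]; field_simp; ring
  have hχcx : conj (S.psi z x - m * S.phi z x) = 0 := by rw [hχx, map_zero]
  simp only [map_one, map_neg] at hL
  rw [hR] at hL
  have key : conj m - m + (z - conj z) *
      ((∫ u in Icc 0 x, ‖S.psi z u - m * S.phi z u‖ ^ 2 ∂S.massMeasure : ℝ) : ℂ) = 0 := by
    linear_combination -hL +
      (1 - conj z * ∫ u in Icc 0 x, conj (S.psi z u - m * S.phi z u) ∂S.massMeasure) * hχx -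
      (1 - z * ∫ u in Icc 0 x, (S.psi z u - m * S.phi z u) ∂S.massMeasure) * hχcx
  have hi := congrArg Complex.im key
  simp at hi
  linear_combination (-1 / 2 : ℝ) * hi

/-- The Herglotz property of the finite-depth Weyl quotients: `Im(ψ(x,z)/φ(x,z)) · Im z ≥ 0`.
[cite: KacKrein1974, §2] -/
theorem im_psi_div_phi_mul_im_nonneg {z : ℂ} (hz : z.im ≠ 0) {x : ℝ} (hx : x ∈ S.dom) :
    0 ≤ (S.psi z x / S.phi z x).im * z.im := by
  rw [S.im_psi_div_phi hz hx]
  have : 0 ≤ ∫ u in Icc 0 x, ‖S.psi z u - S.psi z x / S.phi z x * S.phi z u‖ ^ 2 ∂S.massMeasure :=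
    integral_nonneg (fun u => by positivity)
  nlinarith [mul_self_nonneg z.im]

end KreinString

end Literature.Analysis.InverseSpectral

end
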